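import Mathlib
import Summits.QuantumFields.YangMills.Theses.CoarseStiffnessTail
import Summits.QuantumFields.YangMills.Theorems.CoarseStiffnessTailCappedCoarseStiffnessLUnitPolyTail

/-!
# Route `CoarseStiffnessTail` (rev 1 «unit-poly-tail») — THE GLUE `HistoryTailOfUnitPolyTail` (stmt-QuantumFields-24029), PROVED:
# the power-law unit-scale single-plaquette tail S1_poly = `UnitPolyTailL` implies the parent route's `UnitScaleTilt.HistoryTailL`

Prover seat `ym-line-cst-p1` (g23), route `CoarseStiffnessTail` (ideator `ym-r3-idea-2`, LINE 20; rung R3 = the RECORD leaf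
`T3YM3TorusStatement.YM3TorusSU2`, NOT the Clay statement; nothing here proves a rung or the summit).

The item is the support decl `HistoryTailOfUnitPolyTail : UnitPolyTailL → UnitScaleTilt.HistoryTailL` of the re-typed route: the deciding crux
`UnitPolyTailL` (stmt-QuantumFields-24027, OPEN) — for every block size `L` and thresholds `(b₁, p₁)` a profile `(b₀, p₀)` beyond them, an exponent
`s > 3`, `C ≥ 0`, `γ₁ ∈ (0, 1]` with `Gibbs_K{θBal(L, γ, b₀, p₀, 0) ≤ |Ū^K(∂a) − 1|} ≤ C·γ^s` for every family `F` with `F.L = L`, every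
`0 < γ ≤ γ₁`, every cut-off `K` and every unit plaquette `a` — implies the tail binder `HistoryTailL` of the parent route `UnitScaleTilt`
(stmt-QuantumFields-19936).  The mathematics is the landed `CoarseStiffnessTailUnitPolyTail.historyTailL_of_unitPolyTail` (✓p687579, g22: the
refinement orbit `(F.refine d, γL^{-d})` turns the top slice into every height, the union bound over the `≤ 72·L^{3m}·L^{3i}` depth-`i` plaquettes
against the tail `C·(γL^{-i})^s` is summable exactly because `s > 3 = d`, then `historyTailAt_of_averagedTailAt`); this file only matches the
route's definition `UnitPolyTailL` — verbatim the hypothesis of that theorem — against it.  It cannot be inlined in the route's `closes` because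
that Theorems module imports the route file.

[cite: Balaban1985UV3, (7) p.257 and (71) p.273]
-/

noncomputable section

namespace Summit.QuantumFields.YangMills.Theorems.CoarseStiffnessTailHistoryTailOfUnitPolyTail

open Summit.QuantumFields.YangMills.Theses.CoarseStiffnessTail
open Summit.QuantumFields.YangMills.Theorems.CoarseStiffnessTailUnitPolyTail (historyTailL_of_unitPolyTail)

/-- **`HistoryTailOfUnitPolyTail` holds** (stmt-QuantumFields-24029, support glue of route `CoarseStiffnessTail` rev 1): the power-law
unit-scale single-plaquette tail `UnitPolyTailL` (S1_poly, crux stmt-QuantumFields-24027, OPEN) implies the parent route's history-tail binder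
`UnitScaleTilt.HistoryTailL` (stmt-QuantumFields-19936) — by `historyTailL_of_unitPolyTail`, whose hypothesis is the body of `UnitPolyTailL`
verbatim.  An implication between two OPEN statements; no rung and no summit statement is proved. [cite: Balaban1985UV3, (71) p.273] -/
theorem historyTailOfUnitPolyTail_proof : HistoryTailOfUnitPolyTail := by
  unfold HistoryTailOfUnitPolyTail UnitPolyTailL
  intro hP
  exact historyTailL_of_unitPolyTail hP

end Summit.QuantumFields.YangMills.Theorems.CoarseStiffnessTailHistoryTailOfUnitPolyTail

end
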